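import Summits.ResolutionOfSingularities.ResolutionOfSingularities.Theorems.WeightedInvariantIota3IsoSuccIsolated
import HarnessLib

/-!
# Point moves VII: OFF the exceptional divisor the transform reads the order DOWNSTAIRS — the equimultiple primes below a successor that miss `t⁻¹`
# are exactly those over the equimultiple locus of the start (door `HypersurfaceCentreConstruction`, stmt-ResolutionOfSingularities-19897; stub
# `stub_keyRungGrHomLE_three`, residual (D-b³-point-STAT-REST): TIE / CROSSING point regimes)

Topic: `Summits/ResolutionOfSingularities/ResolutionOfSingularities/Theorems`.  DEF-FREE.  Helper `--supports stmt-ResolutionOfSingularities-19897`.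

The ISOLATED regime of (D-b³-point-STAT) is reduced to the `σ`-comparison (…KeyRungThreeOfDropPointSigma).  For the remaining point regimes (TIE
`(ε, τ) = (0, 1)`, CROSSING `(1, 0)`) the equimultiple locus of the start is a CURVE (or a non-permissible set) through the closed point, and the letter
`ε` at a successor `𝔫` must be read on BOTH kinds of primes `𝔮 < 𝔫`: those containing `t⁻¹` (no order-stationary one when `ε ≠ 1`:
…KeyRungThreeOfDropPointEps) and those missing `t⁻¹`.  This file settles the latter kind for EVERY start and EVERY point-centre presentation:

* `LocalGameEFTPointMove.iotaOrd_transform_atPrime_eq_of_tInv_not_mem` — `t⁻¹ ∉ 𝔮`, `f = (t⁻¹)ᵃ g` ⟹ `ord_{B_𝔮}(g/1) = ord_{S_{𝔮 ∩ S}}(f)`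
  (…IotaOrderOffExceptional + `t⁻¹` a unit at `𝔮`).
* `LocalGameEFTPointMove.comap_ne_maximalIdeal_of_tInv_not_mem` — a prime `𝔮 ∌ t⁻¹` below an off-vertex ideal does not lie over the closed point
  (else every `uᵢ t^{wᵢ} ∈ 𝔮`, i.e. the vertex).
* **`LocalGameEFTPointMove.iotaOrd_transform_atPrime_eq_iff_mem_topStratum`** — for such `𝔮`: `ord_{B_𝔮}(g/1) = ord_S f ↔ 𝔮 ∩ S ∈ Σ(S, f)`
  (the equimultiple locus of the start); in particular `< ord_S f` off `Σ(S, f)` (`iotaOrd_transform_atPrime_lt_of_not_mem_topStratum`).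

[OURS · L1 W4.3 · audit glue; AI work, weaker than expert review; nothing here is a statement of the manuscript under review (Hironaka 2017,
[claim: Hironaka2017, status: under-review]).]

## References

* J. Włodarczyk, *Functorial resolution by torus actions*, arXiv:2203.03090, Def. 2.3.5. [Wlodarczyk2022]
-/

noncomputable section

open IsLocalRing Literature.AlgebraicGeometry.Resolution
open Summit.ResolutionOfSingularities.ResolutionOfSingularities.Cruxes.HypersurfaceCentreConstruction.LocalEngine
open Summit.ResolutionOfSingularities.ResolutionOfSingularities.Cruxes.HypersurfaceCentreConstruction.LocalEngine.Iota3
  (iotaOrd_extRees_atPrime_eq_of_tInv_not_mem)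

set_option linter.dupNamespace false -- mandated namespace of this single-conjunct summit

namespace Summit.ResolutionOfSingularities.ResolutionOfSingularities.Theorems

namespace LocalGameEFTPointMove

variable {S : Type} [CommRing S] {d : ℕ} (u : Fin d → S) (w : Fin d → ℕ)

/-- **Off `V(t⁻¹)` the transform reads the order downstairs**: `t⁻¹ ∉ 𝔮`, `f = (t⁻¹)ᵃ·g` ⟹ `ord_{B_𝔮}(g/1) = ord_{S_{𝔮 ∩ S}}(f)`.
[cite: Wlodarczyk2022, Def. 2.3.5] (folklore rendering) -/
theorem iotaOrd_transform_atPrime_eq_of_tInv_not_mem (𝔮 : Ideal (extReesAlgebra (weightedMonomialIdeal u w))) [𝔮.IsPrime]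
    (hT : extReesAlgebra.tInv (weightedMonomialIdeal u w) ∉ 𝔮) {f : S} {a : ℕ} {g : extReesAlgebra (weightedMonomialIdeal u w)}
    (hfg : algebraMap S (extReesAlgebra (weightedMonomialIdeal u w)) f = extReesAlgebra.tInv (weightedMonomialIdeal u w) ^ a * g) :
    iotaOrd (Localization.AtPrime 𝔮) (algebraMap _ (Localization.AtPrime 𝔮) g) =
      iotaOrd (Localization.AtPrime (𝔮.comap (algebraMap S (extReesAlgebra (weightedMonomialIdeal u w)))))
        (algebraMap S _ f) := by
  have hunit : IsUnit (algebraMap _ (Localization.AtPrime 𝔮) (extReesAlgebra.tInv (weightedMonomialIdeal u w))) :=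
    IsLocalization.map_units (Localization.AtPrime 𝔮) (⟨_, hT⟩ : 𝔮.primeCompl)
  have h1 : iotaOrd (Localization.AtPrime 𝔮) (algebraMap _ (Localization.AtPrime 𝔮)
      (algebraMap S (extReesAlgebra (weightedMonomialIdeal u w)) f)) =
      iotaOrd (Localization.AtPrime 𝔮) (algebraMap _ (Localization.AtPrime 𝔮) g) := by
    rw [hfg, map_mul, map_pow]
    exact iotaOrd_unitInvariant _ _ _ (hunit.pow a)
  rw [← h1, iotaOrd_extRees_atPrime_eq_of_tInv_not_mem _ 𝔮 hT f]

/-- **A prime `𝔮 ∌ t⁻¹` below an off-vertex ideal does not lie over the closed point** (point centre `(u) = 𝔪`). [folklore] -/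
theorem comap_ne_maximalIdeal_of_tInv_not_mem [IsLocalRing S] (hu : Ideal.span (Set.range u) = maximalIdeal S)
    (𝔮 : Ideal (extReesAlgebra (weightedMonomialIdeal u w))) [𝔮.IsPrime] (hT : extReesAlgebra.tInv (weightedMonomialIdeal u w) ∉ 𝔮)
    {𝔫 : Ideal (extReesAlgebra (weightedMonomialIdeal u w))} (hle : 𝔮 ≤ 𝔫)
    (hV : ¬ extReesAlgebra.vertexIdeal (weightedMonomialIdeal u w) ≤ 𝔫) :
    𝔮.comap (algebraMap S (extReesAlgebra (weightedMonomialIdeal u w))) ≠ maximalIdeal S := by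
  intro heq
  apply hV
  refine (vertexIdeal_le_span_range_uT u w).trans ((Ideal.span_le.mpr ?_).trans hle)
  rintro _ ⟨i, rfl⟩
  have hui : u i ∈ maximalIdeal S := hu ▸ Ideal.subset_span ⟨i, rfl⟩
  rw [← heq, Ideal.mem_comap, algebraMap_u_eq] at hui
  rcases Ideal.IsPrime.mem_or_mem ‹𝔮.IsPrime› hui with h | h
  · exact absurd (Ideal.IsPrime.mem_of_pow_mem ‹𝔮.IsPrime› _ h) hT
  · exact h

/-- **The equimultiple primes below a successor that miss `t⁻¹` are exactly those over the equimultiple locus of the start**: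
`ord_{B_𝔮}(g/1) = ord_S f ↔ (𝔮 ∩ S) ∈ Σ(S, f)`. [OURS · L1 W4.3] -/
theorem iotaOrd_transform_atPrime_eq_iff_mem_topStratum (𝔮 : Ideal (extReesAlgebra (weightedMonomialIdeal u w))) [𝔮.IsPrime]
    (hT : extReesAlgebra.tInv (weightedMonomialIdeal u w) ∉ 𝔮) {f : S} {a : ℕ} {g : extReesAlgebra (weightedMonomialIdeal u w)}
    (hfg : algebraMap S (extReesAlgebra (weightedMonomialIdeal u w)) f = extReesAlgebra.tInv (weightedMonomialIdeal u w) ^ a * g) :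
    iotaOrd (Localization.AtPrime 𝔮) (algebraMap _ (Localization.AtPrime 𝔮) g) = iotaOrd S f ↔
      (⟨𝔮.comap (algebraMap S (extReesAlgebra (weightedMonomialIdeal u w))), Ideal.IsPrime.comap _⟩ : PrimeSpectrum S) ∈
        ContactCylinder.topStratum iotaOrd S f := by
  rw [iotaOrd_transform_atPrime_eq_of_tInv_not_mem u w 𝔮 hT hfg, ContactCylinder.mem_topStratum_iff]

/-- **Off the equimultiple locus of the start the order drops off `V(t⁻¹)`** (regular local `S`): `t⁻¹ ∉ 𝔮`, `(𝔮 ∩ S) ∉ Σ(S, f)` ⟹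
`ord_{B_𝔮}(g/1) < ord_S f`. [OURS · L1 W4.3] -/
theorem iotaOrd_transform_atPrime_lt_of_not_mem_topStratum [IsRegularLocalRing S]
    (𝔮 : Ideal (extReesAlgebra (weightedMonomialIdeal u w))) [𝔮.IsPrime]
    (hT : extReesAlgebra.tInv (weightedMonomialIdeal u w) ∉ 𝔮) {f : S} {a : ℕ} {g : extReesAlgebra (weightedMonomialIdeal u w)}
    (hfg : algebraMap S (extReesAlgebra (weightedMonomialIdeal u w)) f = extReesAlgebra.tInv (weightedMonomialIdeal u w) ^ a * g)
    (hnot : (⟨𝔮.comap (algebraMap S (extReesAlgebra (weightedMonomialIdeal u w))), Ideal.IsPrime.comap _⟩ : PrimeSpectrum S) ∉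
        ContactCylinder.topStratum iotaOrd S f) :
    iotaOrd (Localization.AtPrime 𝔮) (algebraMap _ (Localization.AtPrime 𝔮) g) < iotaOrd S f := by
  rw [iotaOrd_transform_atPrime_eq_of_tInv_not_mem u w 𝔮 hT hfg]
  refine lt_of_le_of_ne ?_ fun h => hnot ?_
  · haveI : (𝔮.comap (algebraMap S (extReesAlgebra (weightedMonomialIdeal u w)))).IsPrime := Ideal.IsPrime.comap _
    exact iotaOrd_generizationMonotone S _ f
  · rw [ContactCylinder.mem_topStratum_iff]
    exact h

end LocalGameEFTPointMove

end Summit.ResolutionOfSingularities.ResolutionOfSingularities.Theorems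

end
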